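import Literature.Analysis.FluidPDE.PassiveVectorTensorDissipationDensity
import Literature.Analysis.FluidPDE.PassiveVectorTensorWeightedGalerkinIdentity
import Literature.Analysis.FluidPDE.PassiveVectorTensorStreamStability
import Literature.Analysis.FunctionSpaces.TorusTransportFluxBound
import Literature.Analysis.ODE.TwoWeightLyapunov
import HarnessLib

/-!
# Weak passive solenoidal vectors with a constant coercive tensor and a LIPSCHITZ carrier:
# the TWO-WEIGHT DISSIPATION FLOOR (no dyadic ladder)

Analysis/FluidPDE proof-support file (everything proved; no definitions, no named facts).  For the flat class
`Torus.IsWeakTensorPassiveVectorOn 0 T 𝔸 b w₀ w` (Frisch (9.57), `A = 0`) with `NearIso 𝔸 lo hi`, `0 < lo`, an `L²`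
weakly divergence-free datum, and a carrier whose slices are continuous and `L`-Lipschitz
(`‖b(s,x) − b(s,y)‖ ≤ L ‖reprc(x − y)‖` a.e. `s`), put `r_k = 8π² lo |k|²` (the modal energy-decay rate of the
window `NearIso`) and let `ω` be a real weight on a finite frequency set `F` with
`0 ≤ ω ≤ 1` and the CORRIDOR condition `log 2 · (1 − ω_k) ≤ (4/5)·r_k τ` for ALL `k` (`ω_k = 0` off `F`, so `F`
contains every mode with `r_k τ < (5/4) log 2`).  If the gradient kernel `∇K_ω = fluxKernelGrad F ω` of the weight
satisfies the numeric condition `L · ∫ ‖reprc z‖³ Σ_a |∇K_ω(z)_a| dz ≤ (4/5)·lo`, then for a.e. `t ∈ (0, τ)`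
(`τ ≤ T`, `A(t) = ½ e^{t log 2/τ}`):

  `A(t)·‖w(t)‖² + (1 − A(t))·Σ_{k∈F} ω_k ‖ŵ(t)(k)‖² ≤ ½ (‖w₀‖² + Σ_{k∈F} ω_k ‖ŵ₀(k)‖²)`

(`ae_twoWeight_decay`).  Ingredients: the weighted Galerkin EQUALITY (`ae_weighted_sum_sq_norm_mFourierCoeff_eq`,
p667850), the energy equality with an integrable dissipation density (`exists_dissipationDensity`), modal coercivity
(`lo_mul_le_re_inner_symbT`), the physical-space flux bound `|Fl| ≤ ¼·L·‖∇w‖²·M₃(∇K_ω)`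
(`TorusTransportFluxBound.abs_weightedFlux_le_of_lipschitz` — the constant is the LIPSCHITZ constant of the
carrier, which is what survives a Lagrangian/phase-modulated carrier), and the scalar two-weight Lyapunov inequality
in the absolutely continuous class (`ODE.TwoWeightLyapunov.twoWeight_lyapunov_le`).  With the upper corridor edge
`ω_k ≤ (1 − r_kτ)₊` the right-hand side is `≤ Σ_k (1 − ½ min(1, r_kτ))‖ŵ₀(k)‖²`: at least HALF of the
dissipation-weighted spectrum `Σ_k min(1, r_k τ)‖ŵ₀(k)‖²` is lost by time `τ`, however the (small-strain) carrier
stirs — the dissipation FLOOR of a window propagator, with no band decomposition.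

Consumer: cell `ad-ideate`, K1L_D `stmt-AnomalousDissipation-27980`, W3-E `stub_effectiveFrameEnergyL` (i)
(crux memo `Lines/onelevel-W3E-k3l-lyapunov.md`, re-plan P3b; the kernel-moment bound `M₃ ≲ ρτ` for the concrete
profile and the propagator packaging are P2/P4).

## Mathlib / tree search
Tree: the files imported above; `enstrophy_time_facts` (a.e. finiteness of `eGradNormSq (w s)`), `eGradNormSq_eq_tsum`,
`hasSum_sq_norm_mFourierCoeff_complexify`, `tendsto_freqBall_atTop`.  Mathlib: `ENNReal.hasSum_toReal`,
`intervalIntegrable_iff_integrableOn_Ioo_of_le`, `intervalIntegral.integral_of_le`.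

## References
* R. Temam, *Navier–Stokes Equations* (1984), Ch. III §1 Lemma 1.2. [`Temam1984`]
* R. J. DiPerna, P.-L. Lions, Invent. Math. 98 (1989), §II.1, Lemma II.1. [`DiPernaLions1989`]
* U. Frisch, *Turbulence* (CUP 1995), §9.6.3 eq. (9.57) p. 233. [`Frisch1995Turbulence`]
-/

noncomputable section

open MeasureTheory Set Filter Function TopologicalSpace Complex UnitAddTorus
open scoped ENNReal NNReal InnerProductSpace Topology ComplexConjugate

namespace Literature.Analysis.FluidPDE

namespace Torus

variable {d : Type*} [Fintype d] [DecidableEq d]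

/-! ## Spectral bookkeeping of one slice: the dissipation-weighted energy as a `HasSum` -/

omit [DecidableEq d] in
/-- For `v ∈ L²` with finite spectral gradient norm, `Σ_k |k|² ‖v̂(k)‖² = (eGradNormSq v).toReal/(4π²)` as a
`HasSum`. [cite: Temam1984, Ch. III §1.1] -/
theorem hasSum_freqNormSq_mul_sq_norm (v : UnitAddTorus d → EuclideanSpace ℝ d)
    (hv : FunctionSpaces.Torus.eGradNormSq v ≠ ⊤) :
    HasSum (fun k : d → ℤ => FunctionSpaces.Torus.freqNormSq k *
        ‖mFourierCoeff (FunctionSpaces.EuclideanSpace.complexify ∘ v) k‖ ^ 2)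
      ((FunctionSpaces.Torus.eGradNormSq v).toReal / (4 * Real.pi ^ 2)) := by
  set f : (d → ℤ) → ℝ≥0∞ := fun k => ENNReal.ofReal (FunctionSpaces.Torus.freqNormSq k) *
    ‖mFourierCoeff (FunctionSpaces.EuclideanSpace.complexify ∘ v) k‖ₑ ^ 2 with hf
  have heq : FunctionSpaces.Torus.eGradNormSq v = ENNReal.ofReal (4 * Real.pi ^ 2) * ∑' k, f k :=
    FunctionSpaces.Torus.eGradNormSq_eq_tsum v
  have h4 : (0:ℝ) < 4 * Real.pi ^ 2 := by positivity
  have hT : ∑' k, f k ≠ ⊤ := by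
    intro htop
    rw [htop, ENNReal.mul_top (by simp)] at heq
    exact hv heq
  have hsum := ENNReal.hasSum_toReal hT
  have hterm : ∀ k, (f k).toReal = FunctionSpaces.Torus.freqNormSq k *
      ‖mFourierCoeff (FunctionSpaces.EuclideanSpace.complexify ∘ v) k‖ ^ 2 := by
    intro k
    rw [hf]
    simp only
    rw [ENNReal.toReal_mul, ENNReal.toReal_ofReal (FunctionSpaces.Torus.freqNormSq_nonneg k), ← ofReal_norm,
      ← ENNReal.ofReal_pow (norm_nonneg _), ENNReal.toReal_ofReal (sq_nonneg _)]
  have e : (fun k => (f k).toReal) = fun k => FunctionSpaces.Torus.freqNormSq k *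
      ‖mFourierCoeff (FunctionSpaces.EuclideanSpace.complexify ∘ v) k‖ ^ 2 := funext hterm
  rw [e] at hsum
  have hval : (∑' k, FunctionSpaces.Torus.freqNormSq k *
      ‖mFourierCoeff (FunctionSpaces.EuclideanSpace.complexify ∘ v) k‖ ^ 2) =
      (FunctionSpaces.Torus.eGradNormSq v).toReal / (4 * Real.pi ^ 2) := by
    rw [← tsum_congr hterm, ← ENNReal.tsum_toReal_eq (fun k => ENNReal.ne_top_of_tsum_ne_top hT k), heq,
      ENNReal.toReal_mul, ENNReal.toReal_ofReal h4.le]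
    field_simp
  rw [← hval]
  exact hsum

namespace IsWeakTensorPassiveVectorOn

variable {T : ℝ} {𝔸 : Visc4 d} {b w : ℝ → UnitAddTorus d → EuclideanSpace ℝ d} {w₀ : UnitAddTorus d → EuclideanSpace ℝ d}

/-- **THE TWO-WEIGHT DISSIPATION FLOOR** for weak passive solenoidal vectors with a constant coercive tensor and a
Lipschitz carrier (see the module docstring for the statement and the hypotheses).
[cite: Temam1984, Ch. III §1 Lemma 1.2] [cite: DiPernaLions1989, §II.1 Lemma II.1] -/
theorem ae_twoWeight_decay (h : IsWeakTensorPassiveVectorOn 0 T 𝔸 b w₀ w) {lo hi : ℝ}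
    (h𝔸 : NearIso 𝔸 lo hi) (hlo : 0 < lo) (hw₀ : MemLp w₀ 2 volume)
    (hdiv₀ : FunctionSpaces.Torus.IsWeaklyDivFree w₀)
    (hb : MemLp (FunctionSpaces.Torus.stLift b) ∞ (volume.restrict (Ioo 0 T ×ˢ univ)))
    (hbc : ∀ᵐ s ∂(volume.restrict (Ioo 0 T)), Continuous (b s))
    {L : ℝ} (hL0 : 0 ≤ L)
    (hbL : ∀ᵐ s ∂(volume.restrict (Ioo 0 T)), ∀ x y, ‖b s x - b s y‖ ≤ L * ‖FunctionSpaces.Torus.reprc (x - y)‖)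
    {τ : ℝ} (hτ : 0 < τ) (hτT : τ ≤ T) (F : Finset (d → ℤ)) (ω : (d → ℤ) → ℝ)
    (hωF : ∀ k, k ∉ F → ω k = 0) (hω0 : ∀ k, 0 ≤ ω k) (hω1 : ∀ k, ω k ≤ 1)
    (hωlo : ∀ k, Real.log 2 * (1 - ω k) ≤ 4 / 5 * (8 * Real.pi ^ 2 * lo * FunctionSpaces.Torus.freqNormSq k * τ))
    (hM : L * (∫ z, ‖FunctionSpaces.Torus.reprc z‖ ^ 3 * ∑ a, |FunctionSpaces.Torus.fluxKernelGrad F ω a z|) ≤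
      4 / 5 * lo) :
    ∀ᵐ t ∂(volume.restrict (Ioo 0 τ)),
      1 / 2 * Real.exp (Real.log 2 * t / τ) * (∫ x, ‖w t x‖ ^ 2) +
          (1 - 1 / 2 * Real.exp (Real.log 2 * t / τ)) *
            (∑ k ∈ F, ω k * ‖mFourierCoeff (FunctionSpaces.EuclideanSpace.complexify ∘ w t) k‖ ^ 2) ≤
        1 / 2 * ((∫ x, ‖w₀ x‖ ^ 2) +
          ∑ k ∈ F, ω k * ‖mFourierCoeff (FunctionSpaces.EuclideanSpace.complexify ∘ w₀) k‖ ^ 2) := by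
  classical
  have hT : 0 < T := hτ.trans_le hτT
  -- ### notation
  set X : (d → ℤ) → ℝ → EuclideanSpace ℂ d := fun k s =>
    mFourierCoeff (FunctionSpaces.EuclideanSpace.complexify ∘ w s) k with hX
  set X₀ : (d → ℤ) → EuclideanSpace ℂ d := fun k =>
    mFourierCoeff (FunctionSpaces.EuclideanSpace.complexify ∘ w₀) k with hX₀
  set r : (d → ℤ) → ℝ := fun k => 8 * Real.pi ^ 2 * lo * FunctionSpaces.Torus.freqNormSq k with hr
  set E : ℝ → ℝ := fun s => ∫ x, ‖w s x‖ ^ 2 with hE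
  set E₀ : ℝ := ∫ x, ‖w₀ x‖ ^ 2 with hE₀
  set S : ℝ → ℝ := fun s => ∑ k ∈ F, ω k * ‖X k s‖ ^ 2 with hS
  set S₀ : ℝ := ∑ k ∈ F, ω k * ‖X₀ k‖ ^ 2 with hS₀
  set Q : ℕ → ℝ → ℝ := fun N s => 4 * Real.pi ^ 2 * ∑ k ∈ FunctionSpaces.Torus.freqBall N,
    (⟪X k s, symbT 𝔸 k (X k s)⟫_ℂ).re with hQ
  set D : ℝ → ℝ := fun s => 4 * Real.pi ^ 2 * ∑ k ∈ F, ω k * (⟪X k s, symbT 𝔸 k (X k s)⟫_ℂ).re with hD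
  set Fl : ℝ → ℝ := fun s =>
    (∫ x, ⟪w s x, FunctionSpaces.Torus.convect (b s) (fun y => ∑ k ∈ F, ω k •
        FunctionSpaces.Torus.realTrigPoly {k} (fun k' => X k' s) y) x⟫_ℝ) +
      (0:ℝ) * ∫ x, ⟪b s x, FunctionSpaces.Torus.convect (w s) (fun y => ∑ k ∈ F, ω k •
        FunctionSpaces.Torus.realTrigPoly {k} (fun k' => X k' s) y) x⟫_ℝ with hFl
  set G : ℝ → ℝ := fun s => 2 * lo * (FunctionSpaces.Torus.eGradNormSq (w s)).toReal with hG
  set M₃ : ℝ := ∫ z, ‖FunctionSpaces.Torus.reprc z‖ ^ 3 * ∑ a, |FunctionSpaces.Torus.fluxKernelGrad F ω a z|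
    with hM₃
  have hr0 : ∀ k, 0 ≤ r k := fun k => by rw [hr]; exact mul_nonneg (by positivity) (FunctionSpaces.Torus.freqNormSq_nonneg k)
  -- ### the dissipation density
  obtain ⟨q, hqint, hqQ, hq0, hqE⟩ := h.exists_dissipationDensity h𝔸 hlo hw₀ hdiv₀ hb
  -- ### a.e. finiteness of the gradient norm
  obtain ⟨_, _, hgradfin, _⟩ := h.enstrophy_time_facts h𝔸 hlo hw₀ hdiv₀ hb
  -- ### a.e.-in-`s` facts on `(0,T)`
  have htr := ae_all_iff.2 fun k => h.ae_sum_mul_mFourierCoeff_eq_zero k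
  have hnn : ∀ᵐ s ∂(volume.restrict (Ioo 0 T)), ∀ k : d → ℤ, 0 ≤ (⟪X k s, symbT 𝔸 k (X k s)⟫_ℂ).re :=
    h.ae_re_inner_symbT_nonneg h𝔸 hlo.le
  -- (G) the dissipation-weighted energy as a `HasSum`, and its partial sums
  have hGsum : ∀ᵐ s ∂(volume.restrict (Ioo 0 T)), HasSum (fun k => r k * ‖X k s‖ ^ 2) (G s) := by
    filter_upwards [hgradfin] with s hs
    have h1 := (hasSum_freqNormSq_mul_sq_norm (w s) hs.ne).mul_left (8 * Real.pi ^ 2 * lo)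
    have e : 8 * Real.pi ^ 2 * lo * ((FunctionSpaces.Torus.eGradNormSq (w s)).toReal / (4 * Real.pi ^ 2)) = G s := by
      rw [hG]; field_simp; ring
    rw [e] at h1
    refine h1.congr_fun fun k => ?_
    simp only [hr]; ring
  have hG0 : ∀ᵐ s ∂(volume.restrict (Ioo 0 T)), 0 ≤ G s := ae_of_all _ fun s => by
    rw [hG]; exact mul_nonneg (mul_nonneg two_pos.le hlo.le) ENNReal.toReal_nonneg
  -- (coercivity) `a G ≤ 2 a q + 2 (1 − a) D` for `a ∈ [½, 1]`
  have hcoer : ∀ᵐ s ∂(volume.restrict (Ioo 0 T)), ∀ a : ℝ, 1 / 2 ≤ a → a ≤ 1 →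
      a * G s ≤ 2 * a * q s + 2 * (1 - a) * D s := by
    filter_upwards [hGsum, htr, hnn, hqQ] with s hsG hs htnn hsq
    intro a ha hale
    have ha0 : 0 ≤ a := by linarith
    -- partial sums over frequency balls containing `F`
    obtain ⟨N₀, hN₀⟩ : ∃ N₀ : ℕ, F ⊆ FunctionSpaces.Torus.freqBall N₀ :=
      ((Filter.tendsto_atTop.1 (FunctionSpaces.Torus.tendsto_freqBall_atTop (d := d))) F).exists
    have hlim : Tendsto (fun N : ℕ => a * ∑ k ∈ FunctionSpaces.Torus.freqBall N, r k * ‖X k s‖ ^ 2) atTop (𝓝 (a * G s)) :=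
      ((hsG.comp FunctionSpaces.Torus.tendsto_freqBall_atTop).const_mul a)
    refine le_of_tendsto' hlim fun N => ?_
    -- for `N ≥ N₀`-type comparisons we bound by the ball `max N N₀`… simpler: monotone in the ball, so use `N' := max N N₀`
    have hsubN : FunctionSpaces.Torus.freqBall N ⊆ FunctionSpaces.Torus.freqBall (max N N₀) :=
      FunctionSpaces.Torus.freqBall_mono (d := d) (le_max_left N N₀)
    have hsubF : F ⊆ FunctionSpaces.Torus.freqBall (max N N₀) := hN₀.trans (FunctionSpaces.Torus.freqBall_mono (d := d) (le_max_right N N₀))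
    set B : Finset (d → ℤ) := FunctionSpaces.Torus.freqBall (d := d) (max N N₀) with hB
    -- termwise coercivity on the ball `B`
    have hterm : ∀ k, r k * ‖X k s‖ ^ 2 ≤ 2 * (4 * Real.pi ^ 2 * (⟪X k s, symbT 𝔸 k (X k s)⟫_ℂ).re) := by
      intro k
      have := lo_mul_le_re_inner_symbT h𝔸 (hs k)
      simp only [hr]
      nlinarith [this, Real.pi_pos]
    -- `a Σ_{ball N} ≤ a Σ_B = a Σ_B (1-ω) + a Σ_B ω ≤ a·2(Q_B − D) + Σ_B ω r ≤ 2a(q − D) + 2D`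
    have hstep1 : a * ∑ k ∈ FunctionSpaces.Torus.freqBall N, r k * ‖X k s‖ ^ 2 ≤ a * ∑ k ∈ B, r k * ‖X k s‖ ^ 2 :=
      mul_le_mul_of_nonneg_left (Finset.sum_le_sum_of_subset_of_nonneg hsubN fun k _ _ =>
        mul_nonneg (hr0 k) (sq_nonneg _)) ha0
    have hsplit : ∑ k ∈ B, r k * ‖X k s‖ ^ 2 =
        (∑ k ∈ B, (1 - ω k) * (r k * ‖X k s‖ ^ 2)) + ∑ k ∈ B, ω k * (r k * ‖X k s‖ ^ 2) := by
      rw [← Finset.sum_add_distrib]; refine Finset.sum_congr rfl fun k _ => ?_; ring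
    have hDB : D s = 4 * Real.pi ^ 2 * ∑ k ∈ B, ω k * (⟪X k s, symbT 𝔸 k (X k s)⟫_ℂ).re := by
      rw [hD]
      simp only
      congr 1
      exact Finset.sum_subset hsubF fun k _ hkF => by rw [hωF k hkF, zero_mul]
    have hQB : Q (max N N₀) s = 4 * Real.pi ^ 2 * ∑ k ∈ B, (⟪X k s, symbT 𝔸 k (X k s)⟫_ℂ).re := rfl
    have h1 : ∑ k ∈ B, (1 - ω k) * (r k * ‖X k s‖ ^ 2) ≤ 2 * (Q (max N N₀) s - D s) := by
      rw [hQB, hDB, ← mul_sub, ← Finset.sum_sub_distrib, Finset.mul_sum, Finset.mul_sum]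
      refine Finset.sum_le_sum fun k _ => ?_
      have h1k := hterm k
      have hω' : 0 ≤ 1 - ω k := by linarith [hω1 k]
      calc (1 - ω k) * (r k * ‖X k s‖ ^ 2) ≤ (1 - ω k) * (2 * (4 * Real.pi ^ 2 * (⟪X k s, symbT 𝔸 k (X k s)⟫_ℂ).re)) :=
            mul_le_mul_of_nonneg_left h1k hω'
        _ = 2 * (4 * Real.pi ^ 2 * ((⟪X k s, symbT 𝔸 k (X k s)⟫_ℂ).re - ω k * (⟪X k s, symbT 𝔸 k (X k s)⟫_ℂ).re)) := by ring
    have h2 : ∑ k ∈ B, ω k * (r k * ‖X k s‖ ^ 2) ≤ 2 * D s := by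
      rw [hDB, Finset.mul_sum, Finset.mul_sum]
      refine Finset.sum_le_sum fun k _ => ?_
      calc ω k * (r k * ‖X k s‖ ^ 2) ≤ ω k * (2 * (4 * Real.pi ^ 2 * (⟪X k s, symbT 𝔸 k (X k s)⟫_ℂ).re)) :=
            mul_le_mul_of_nonneg_left (hterm k) (hω0 k)
        _ = 2 * (4 * Real.pi ^ 2 * (ω k * (⟪X k s, symbT 𝔸 k (X k s)⟫_ℂ).re)) := by ring
    have h2nn : 0 ≤ ∑ k ∈ B, ω k * (r k * ‖X k s‖ ^ 2) :=
      Finset.sum_nonneg fun k _ => mul_nonneg (hω0 k) (mul_nonneg (hr0 k) (sq_nonneg _))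
    have hqN := hsq (max N N₀)
    have hDnn : 0 ≤ D s := by
      rw [hDB]; exact mul_nonneg (by positivity) (Finset.sum_nonneg fun k _ => mul_nonneg (hω0 k) (htnn k))
    calc a * ∑ k ∈ FunctionSpaces.Torus.freqBall N, r k * ‖X k s‖ ^ 2
        ≤ a * ∑ k ∈ B, r k * ‖X k s‖ ^ 2 := hstep1
      _ = a * (∑ k ∈ B, (1 - ω k) * (r k * ‖X k s‖ ^ 2)) + a * ∑ k ∈ B, ω k * (r k * ‖X k s‖ ^ 2) := by
          rw [hsplit, mul_add]
      _ ≤ a * (2 * (Q (max N N₀) s - D s)) + 1 * ∑ k ∈ B, ω k * (r k * ‖X k s‖ ^ 2) :=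
          add_le_add (mul_le_mul_of_nonneg_left h1 ha0) (mul_le_mul_of_nonneg_right hale h2nn)
      _ ≤ a * (2 * (q s - D s)) + 2 * D s := by
          refine add_le_add (mul_le_mul_of_nonneg_left (by linarith) ha0) (by linarith)
      _ = 2 * a * q s + 2 * (1 - a) * D s := by ring
  -- (corridor) `E − S ≤ (4/5)(τ/log 2) G`
  have hlog : 0 < Real.log 2 := Real.log_pos (by norm_num)
  have hcorr : ∀ᵐ s ∂(volume.restrict (Ioo 0 T)), E s - S s ≤ 4 / 5 * (τ / Real.log 2) * G s := by
    filter_upwards [hGsum, h.ae_memLp_two] with s hsG hs2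
    -- `E s = Σ' ‖X k s‖²`, `S s = Σ' ω_k ‖X k s‖²`
    have hPars : HasSum (fun k => ‖X k s‖ ^ 2) (E s) := FunctionSpaces.Torus.hasSum_sq_norm_mFourierCoeff_complexify hs2
    have hSsum : HasSum (fun k => ω k * ‖X k s‖ ^ 2) (S s) := by
      rw [hS]
      exact hasSum_sum_of_ne_finset_zero (fun k hk => by rw [hωF k hk, zero_mul])
    have hdiff : HasSum (fun k => (1 - ω k) * ‖X k s‖ ^ 2) (E s - S s) := by
      have := hPars.sub hSsum
      refine this.congr_fun fun k => ?_
      ring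
    have hrhs : HasSum (fun k => 4 / 5 * (τ / Real.log 2) * (r k * ‖X k s‖ ^ 2)) (4 / 5 * (τ / Real.log 2) * G s) :=
      hsG.mul_left _
    refine hasSum_le (fun k => ?_) hdiff hrhs
    have hk := hωlo k
    have hX0 : 0 ≤ ‖X k s‖ ^ 2 := sq_nonneg _
    -- `(1 − ω_k) ≤ (4/5)(τ/log 2) r_k`
    have hcoef : 1 - ω k ≤ 4 / 5 * (τ / Real.log 2) * r k := by
      show 1 - ω k ≤ 4 / 5 * (τ / Real.log 2) * (8 * Real.pi ^ 2 * lo * FunctionSpaces.Torus.freqNormSq k)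
      have h1 : 1 - ω k ≤ 4 / 5 * (8 * Real.pi ^ 2 * lo * FunctionSpaces.Torus.freqNormSq k * τ) / Real.log 2 :=
        (le_div_iff₀' hlog).2 hk
      calc 1 - ω k ≤ 4 / 5 * (8 * Real.pi ^ 2 * lo * FunctionSpaces.Torus.freqNormSq k * τ) / Real.log 2 := h1
        _ = 4 / 5 * (τ / Real.log 2) * (8 * Real.pi ^ 2 * lo * FunctionSpaces.Torus.freqNormSq k) := by
            field_simp
    calc (1 - ω k) * ‖X k s‖ ^ 2 ≤ (4 / 5 * (τ / Real.log 2) * r k) * ‖X k s‖ ^ 2 :=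
          mul_le_mul_of_nonneg_right hcoef hX0
      _ = 4 / 5 * (τ / Real.log 2) * (r k * ‖X k s‖ ^ 2) := by ring
  -- (flux) `Fl = Σ_F ω_k Re B_k` and `|Fl| ≤ G/10`
  have hflux : ∀ᵐ s ∂(volume.restrict (Ioo 0 T)), |Fl s| ≤ 1 / 10 * G s := by
    filter_upwards [h.ae_weightedFlux_eq_sum, h.ae_memLp_two, hgradfin, hbc, hbL, h.ae_isWeaklyDivFree_carrier]
      with s hsf hs2 hsg hsc hsL hsdiv
    have e1 : Fl s = ∑ k ∈ F, ω k * (∑ a, (2 * Real.pi * I * (k a : ℂ)) *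
        ⟪mFourierCoeff (FunctionSpaces.EuclideanSpace.complexify ∘ fun x => b s x a • w s x) k,
          mFourierCoeff (FunctionSpaces.EuclideanSpace.complexify ∘ w s) k⟫_ℂ).re := by
      rw [hFl]
      simp only
      rw [hsf F ω]
      refine Finset.sum_congr rfl fun k _ => ?_
      simp
    rw [e1]
    have hP := FunctionSpaces.Torus.abs_weightedFlux_le_of_lipschitz hs2 hsg.ne hsc hsdiv hL0 hsL F ω
    refine hP.trans ?_
    -- `¼ L ‖∇w‖² M₃ = (L M₃/(8 lo)) G ≤ G/10`
    have hEg : (FunctionSpaces.Torus.eGradNormSq (w s)).toReal = G s / (2 * lo) := by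
      rw [hG]; field_simp
    rw [hEg]
    have hGs : 0 ≤ G s := by rw [hG]; exact mul_nonneg (mul_nonneg two_pos.le hlo.le) ENNReal.toReal_nonneg
    have hM' : L * M₃ ≤ 4 / 5 * lo := hM
    rw [show 1 / 4 * L * (G s / (2 * lo)) * M₃ = (L * M₃) * G s / (8 * lo) by ring]
    rw [div_le_iff₀ (by positivity)]
    nlinarith [hM', hGs]
  -- ### the two identities at a.e. `t`: weighted Galerkin identity and energy equality with density
  have hSid : ∀ᵐ t ∂(volume.restrict (Ioo 0 T)),
      S t = S₀ - 2 * (∫ s in Ioc 0 t, D s) + 2 * ∫ s in Ioc 0 t, Fl s := by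
    filter_upwards [h.ae_weighted_sum_sq_norm_mFourierCoeff_eq hw₀ hdiv₀] with t ht
    have := ht F ω
    rw [hS, hS₀, hD, hFl]
    simp only at this ⊢
    linarith
  have hEid : ∀ᵐ t ∂(volume.restrict (Ioo 0 T)), E t = E₀ - 2 * ∫ s in Ioc 0 t, q s := by
    filter_upwards [hqE] with t ht
    rw [ht, hE, hE₀]
    ring
  -- ### pass to `∀ᵐ s, s ∈ uIcc 0 τ → …` (the endpoints are null)
  have hIcc : ∀ {P : ℝ → Prop}, (∀ᵐ s ∂(volume.restrict (Ioo 0 T)), P s) → ∀ᵐ s, s ∈ uIcc (0:ℝ) τ → P s := by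
    intro P hP
    have hP' : ∀ᵐ s ∂(volume : Measure ℝ), s ∈ Ioo 0 T → P s := (ae_restrict_iff' measurableSet_Ioo).1 hP
    have h0 : ∀ᵐ s ∂(volume : Measure ℝ), s ≠ 0 := by simp [ae_iff, measure_singleton]
    have hT' : ∀ᵐ s ∂(volume : Measure ℝ), s ≠ T := by simp [ae_iff, measure_singleton]
    filter_upwards [hP', h0, hT'] with s hs hs0 hsT hsI
    rw [uIcc_of_le hτ.le] at hsI
    exact hs ⟨lt_of_le_of_ne hsI.1 (Ne.symm hs0), lt_of_le_of_ne (hsI.2.trans hτT) hsT⟩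
  -- ### interval integrability
  have hIoo : Ioo (0:ℝ) τ ⊆ Ioo 0 T := Ioo_subset_Ioo le_rfl hτT
  have hqI : IntervalIntegrable q volume 0 τ :=
    (intervalIntegrable_iff_integrableOn_Ioo_of_le hτ.le).2 (hqint.mono_set hIoo)
  have hDI : IntervalIntegrable D volume 0 τ :=
    (intervalIntegrable_iff_integrableOn_Ioo_of_le hτ.le).2 ((h.integrableOn_weightedSymbForm F ω).mono_set hIoo)
  have hFlI : IntervalIntegrable Fl volume 0 τ :=
    (intervalIntegrable_iff_integrableOn_Ioo_of_le hτ.le).2 ((h.integrableOn_weightedFlux F ω).mono_set hIoo)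
  -- ### the scalar two-weight lemma
  have h1' : ∀ᵐ t, t ∈ uIcc (0:ℝ) τ →
      (E₀ - 2 * ∫ s in (0:ℝ)..t, q s) - (S₀ - 2 * (∫ s in (0:ℝ)..t, D s) + 2 * ∫ s in (0:ℝ)..t, Fl s) ≤
        4 / 5 * (τ / Real.log 2) * G t := by
    have := hIcc ((hcorr.and hSid).and hEid)
    filter_upwards [this] with t ht htI
    obtain ⟨⟨hc, hs⟩, he⟩ := ht htI
    have ht0 : 0 ≤ t := by rw [uIcc_of_le hτ.le] at htI; exact htI.1
    rw [intervalIntegral.integral_of_le ht0, intervalIntegral.integral_of_le ht0, intervalIntegral.integral_of_le ht0,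
      ← he, ← hs]
    exact hc
  have hmain := fun (t : ℝ) (ht0 : 0 ≤ t) (htτ : t ≤ τ) =>
    ODE.TwoWeight.twoWeight_lyapunov_le hτ hqI hDI hFlI (hIcc hG0) h1' (hIcc hcoer) (hIcc hflux) ht0 htτ
  -- ### conclude at a.e. `t ∈ (0, τ)`
  have hSid' : ∀ᵐ t ∂(volume.restrict (Ioo 0 τ)), S t = S₀ - 2 * (∫ s in Ioc 0 t, D s) + 2 * ∫ s in Ioc 0 t, Fl s :=
    ae_restrict_of_ae_restrict_of_subset hIoo hSid
  have hEid' : ∀ᵐ t ∂(volume.restrict (Ioo 0 τ)), E t = E₀ - 2 * ∫ s in Ioc 0 t, q s :=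
    ae_restrict_of_ae_restrict_of_subset hIoo hEid
  filter_upwards [hSid', hEid', ae_restrict_mem measurableSet_Ioo] with t hs he htI
  have h := hmain t htI.1.le htI.2.le
  rw [intervalIntegral.integral_of_le htI.1.le, intervalIntegral.integral_of_le htI.1.le,
    intervalIntegral.integral_of_le htI.1.le, ← he, ← hs] at h
  simpa only [hE, hS, hE₀, hS₀, hX, hX₀] using h

end IsWeakTensorPassiveVectorOn

end Torus

end Literature.Analysis.FluidPDE

end
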